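import Literature.NumberTheory.Congruences.BernoulliCharacterTeichmullerCongruence
import HarnessLib

/-!
# Crux `PrintCFram.BottomClassIndexLawFiveLe` (stmt-BirchSwinnertonDyer-20372), line `eisenstein-resource-bdp-line` (registry v19):
# THE KUMMER DICTIONARY, NUMERIC INTERFACE — `‖(j:ℚ_p)⁻¹·B_{j,θ}‖ ≤ p⁻¹` IS «`p` divides the numerator of the rational number
# `∑_{a<c} η(a)·c^{j−1}B_j(a/c)`» for an integer-valued character `θ = η` (decidable rational arithmetic)
# (cell `bsd-print-cfram`, width seat `bsd-line-cfram-p1-w8` g3; THEOREMS ONLY, `--supports` 20372; BSD is not proved by any of this)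

HONEST FRAMING. Nothing here is a statement about BSD; no stub is closed. Parts I–III (p671810, p672442, p673020) put registry v19's two
research stubs in generalized-Bernoulli currency: B1 = «`‖((p−k):ℚ_p)⁻¹ B_{p−k,χ_e}‖ ≤ p⁻¹ ⟹ BSD_p`», C = «`¬ … ⟹ ∃ K'', ε_K,
¬ ‖(k:ℚ_p)⁻¹ B_{k,(χ_e↑ε_K↑)~}‖ ≤ p⁻¹`» (`KummerDictionary.stubB1_iff_bernoulli`, `…stubC_iff_bernoulli`). This file makes the
remaining quantity KERNEL-DECIDABLE: for a character `θ` mod `c ⊥ p` with INTEGER values `η` (the class data of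
`KrizLiBinders.exists_krizLiData_of_cmRamified` come with such `ε`; a Kronecker character is `±1, 0`-valued) and `2 ≤ j ≤ p − 2`,

  `‖(j:ℚ_p)⁻¹ · B_{j,θ}‖ ≤ p⁻¹ ⟺ (p : ℤ) ∣ (∑_{a < c} η(a) · genBernoulliCoeff j c a).num`

(`norm_inv_mul_generalizedBernoulli_le_inv_iff_dvd_num`), where `genBernoulliCoeff j c a = c^{j−1} B_j(a/c) ∈ ℚ` is the tree's weight
(`LFunctions.genBernoulliCoeff`) and `.num` is the numerator of a rational in lowest terms — exactly what bsd-idea-7 g12's census engine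
(`p3_cover_density.py`: `B_{m,χ_G} = F^{m−1} Σ χ_G(a) B_m(a/F)` reduced mod `p`) computes, so each census row is one `decide`/`norm_num`
away from a kernel instance of B1's premise or of a C-witness. Ingredients: `B_{j,θ}` is the cast of that rational
(`generalizedBernoulli_eq_ratCast_sum`); `‖j‖_p = 1`; the rational is `p`-integral (Part 0's `CharacterTwist.norm_generalizedBernoulli_div_le_one`),
so `p ∤` its denominator (`not_dvd_den_of_norm_ratCast_le_one`) and `‖q‖_p ≤ p⁻¹ ⟺ p ∣ q.num` (`norm_ratCast_le_inv_iff_dvd_num`).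
beyond-print theorem: NO.

References: [Washington1997] Thm. 5.11, Cor. 5.13 (integrality of `B_{n,χ}/n`); [LangCyclotomic1990] Ch. 2 §2 B 7; `Lines/kriz-li-cover.md`
(engine), `Lines/kriz-li-cover-P3-jobspec.md`.
-/

set_option autoImplicit false
-- summit-side namespace `Summit.BirchSwinnertonDyer.BirchSwinnertonDyer.…` (single-conjunct summit, D-0017 layout)
set_option linter.dupNamespace false

noncomputable section

open scoped Classical
open DirichletCharacter Literature.NumberTheory.LFunctions Literature.NumberTheory.Congruences

namespace Summit.BirchSwinnertonDyer.BirchSwinnertonDyer.Theorems.PrintCFram.KummerDictionary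

variable {p : ℕ} [hp : Fact p.Prime]

/-! ## §1 `p`-adic size of rationals: numerator / denominator reading -/

/-- A `p`-integral rational has denominator prime to `p`: `‖q‖_p ≤ 1 ⟹ p ∤ q.den` (if `p ∣ den` then `p ∤ num` and `‖q‖_p = p^{v} > 1`).
[cite: Gouvea1993PadicNumbers, §3.3] -/
theorem not_dvd_den_of_norm_ratCast_le_one (q : ℚ) (h : ‖(q : ℚ_[p])‖ ≤ 1) : ¬ p ∣ q.den := by
  intro hden
  have hpp := hp.out
  have hnum : ¬ (p : ℤ) ∣ q.num := by
    intro hnum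
    have hcop := q.reduced
    have h1 : p ∣ q.num.natAbs := Int.natCast_dvd.mp (by simpa using hnum)
    have : p ∣ Nat.gcd q.num.natAbs q.den := Nat.dvd_gcd h1 hden
    rw [hcop] at this
    exact hpp.ne_one (Nat.dvd_one.mp this)
  have hnum1 : ‖(q.num : ℚ_[p])‖ = 1 :=
    le_antisymm (Padic.norm_int_le_one _) (not_lt.mp fun hlt ↦ hnum (Padic.norm_intCast_lt_one_iff.mp hlt))
  have hden1 : ‖(q.den : ℚ_[p])‖ < 1 := by
    have : ‖((q.den : ℤ) : ℚ_[p])‖ < 1 := Padic.norm_intCast_lt_one_iff.mpr (Int.natCast_dvd_natCast.mpr hden)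
    simpa using this
  have hden0 : (q.den : ℚ_[p]) ≠ 0 := by exact_mod_cast q.den_nz
  have hq : (q : ℚ_[p]) = (q.num : ℚ_[p]) / (q.den : ℚ_[p]) := by rw [Rat.cast_def]
  rw [hq, norm_div, hnum1] at h
  have hpos : 0 < ‖(q.den : ℚ_[p])‖ := norm_pos_iff.mpr hden0
  have : 1 ≤ ‖(q.den : ℚ_[p])‖ := by rwa [one_div, inv_le_one₀ hpos] at h
  exact absurd hden1 (not_lt.mpr this)

/-- **`‖q‖_p ≤ p⁻¹ ⟺ p ∣ q.num`** for a rational `q` with `p ∤ q.den`. [cite: Gouvea1993PadicNumbers, §3.3] -/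
theorem norm_ratCast_le_inv_iff_dvd_num (q : ℚ) (hden : ¬ p ∣ q.den) :
    ‖(q : ℚ_[p])‖ ≤ (p : ℝ)⁻¹ ↔ (p : ℤ) ∣ q.num := by
  have hden1 : ‖(q.den : ℚ_[p])‖ = 1 := by
    have h1 : ‖((q.den : ℤ) : ℚ_[p])‖ ≤ 1 := Padic.norm_int_le_one _
    have h2 : ¬ ‖((q.den : ℤ) : ℚ_[p])‖ < 1 := fun hlt ↦
      hden (Int.natCast_dvd_natCast.mp (Padic.norm_intCast_lt_one_iff.mp hlt))
    have : ‖((q.den : ℤ) : ℚ_[p])‖ = 1 := le_antisymm h1 (not_lt.mp h2)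
    simpa using this
  have hq : (q : ℚ_[p]) = (q.num : ℚ_[p]) / (q.den : ℚ_[p]) := by rw [Rat.cast_def]
  rw [hq, norm_div, hden1, div_one]
  have h := Padic.norm_int_le_pow_iff_dvd (p := p) q.num 1
  rw [pow_one] at h
  simpa using h

/-- `‖j‖_p = 1` for `0 < j < p`. [folklore] -/
private theorem norm_natCast_eq_one {j : ℕ} (hj0 : j ≠ 0) (hjp : j < p) : ‖(j : ℚ_[p])‖ = 1 := by
  have hnd : ¬ (p : ℤ) ∣ (j : ℤ) := by
    rw [Int.natCast_dvd_natCast]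
    exact fun h ↦ absurd (Nat.le_of_dvd (Nat.pos_of_ne_zero hj0) h) (not_le.mpr hjp)
  have h1 : ‖((j : ℤ) : ℚ_[p])‖ ≤ 1 := Padic.norm_int_le_one _
  have h2 : ¬ ‖((j : ℤ) : ℚ_[p])‖ < 1 := fun hlt ↦ hnd (Padic.norm_intCast_lt_one_iff.mp hlt)
  have : ‖((j : ℤ) : ℚ_[p])‖ = 1 := le_antisymm h1 (not_lt.mp h2)
  simpa using this

/-- Dividing by a `p`-adic unit `j` (`0 < j < p`) does not change `‖·‖ ≤ p⁻¹`. [folklore] -/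
private theorem norm_inv_natCast_mul_le_inv_iff {j : ℕ} (hj0 : j ≠ 0) (hjp : j < p) (x : ℚ_[p]) :
    ‖(j : ℚ_[p])⁻¹ * x‖ ≤ (p : ℝ)⁻¹ ↔ ‖x‖ ≤ (p : ℝ)⁻¹ := by
  rw [norm_mul, norm_inv, norm_natCast_eq_one hj0 hjp, inv_one, one_mul]

/-! ## §2 `B_{j,θ}` as the cast of a rational number, for an integer-valued `θ` -/

/-- **`B_{j,θ} = ∑_{a<c} η(a)·c^{j−1}B_j(a/c)` read in `ℚ`, then cast to `ℚ_p`,** for a character `θ` mod `c` with integer values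
`η` (`θ(a) = η(a)` for all `a ∈ ℕ`). [cite: LangCyclotomic1990, Ch. 2 §2, B 7 (the display `B_{k,f}`)] -/
theorem generalizedBernoulli_eq_ratCast_sum {c : ℕ} [NeZero c] (θ : DirichletCharacter ℚ_[p] c) (η : ℕ → ℤ)
    (hη : ∀ a : ℕ, θ (a : ZMod c) = (η a : ℚ_[p])) (j : ℕ) :
    generalizedBernoulli j θ = ((∑ a ∈ Finset.range c, (η a : ℚ) * genBernoulliCoeff j c a : ℚ) : ℚ_[p]) := by
  rw [generalizedBernoulli_eq_sum, Rat.cast_sum]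
  have hterm : ∀ x : ZMod c, θ x * algebraMap ℚ ℚ_[p] (genBernoulliCoeff j c x.val) =
      (((η x.val : ℚ) * genBernoulliCoeff j c x.val : ℚ) : ℚ_[p]) := by
    intro x
    rw [← ZMod.natCast_zmod_val x, hη, ZMod.natCast_zmod_val, eq_ratCast]
    push_cast
    ring
  rw [Finset.sum_congr rfl fun x _ ↦ hterm x]
  -- reindex `ZMod c = Fin c` along `val`
  obtain ⟨n, rfl⟩ := Nat.exists_eq_succ_of_ne_zero (NeZero.ne c)
  exact Fin.sum_univ_eq_sum_range (fun a ↦ (((η a : ℚ) * genBernoulliCoeff j (n + 1) a : ℚ) : ℚ_[p])) (n + 1)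

/-! ## §3 The numeric criterion -/

/-- **NUMERIC CRITERION: `‖(j:ℚ_p)⁻¹ · B_{j,θ}‖ ≤ p⁻¹ ⟺ p ∣ num(∑_{a<c} η(a)·c^{j−1}B_j(a/c))`** for `c ⊥ p`, `θ` mod `c` with integer
values `η`, `2 ≤ j ≤ p − 2` (the rational is `p`-integral by the twisted Kummer file's `norm_generalizedBernoulli_div_le_one`, so `p ∤` its
denominator and the `p`-adic size reads on the numerator). With `(c, θ, η, j) = (m, χ_e, ε, p − k)` this is B1's premise in Bernoulli currency
(`stubB1_iff_bernoulli`); with `(cond (χ_e↑ε_K↑)~, (χ_e↑ε_K↑)~, Kronecker values, k)` it is the field factor of C (`stubC_iff_bernoulli`).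
[cite: Washington1997, Thm. 5.11 and Cor. 5.13] [cite: LangCyclotomic1990, Ch. 2 §2, B 7] -/
theorem norm_inv_mul_generalizedBernoulli_le_inv_iff_dvd_num {c : ℕ} [NeZero c] (hcp : c.Coprime p)
    (θ : DirichletCharacter ℚ_[p] c) (η : ℕ → ℤ) (hη : ∀ a : ℕ, θ (a : ZMod c) = (η a : ℚ_[p]))
    {j : ℕ} (h2j : 2 ≤ j) (hjp : j ≤ p - 2) :
    ‖(j : ℚ_[p])⁻¹ * generalizedBernoulli j θ‖ ≤ (p : ℝ)⁻¹ ↔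
      (p : ℤ) ∣ (∑ a ∈ Finset.range c, (η a : ℚ) * genBernoulliCoeff j c a).num := by
  have hj0 : j ≠ 0 := by omega
  have hjp' : j < p := by omega
  set q : ℚ := ∑ a ∈ Finset.range c, (η a : ℚ) * genBernoulliCoeff j c a with hq
  have hB : generalizedBernoulli j θ = (q : ℚ_[p]) := generalizedBernoulli_eq_ratCast_sum θ η hη j
  -- integrality of `q`
  have hint : ‖(q : ℚ_[p])‖ ≤ 1 := by
    have h := CharacterTwist.norm_generalizedBernoulli_div_le_one hcp θ h2j hjp
    rw [hB, norm_mul, norm_inv, norm_natCast_eq_one hj0 hjp', inv_one, one_mul] at h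
    exact h
  rw [norm_inv_natCast_mul_le_inv_iff hj0 hjp', hB]
  exact norm_ratCast_le_inv_iff_dvd_num q (not_dvd_den_of_norm_ratCast_le_one q hint)

/-- **The same without the factor `j⁻¹`: `‖B_{j,θ}‖ ≤ p⁻¹ ⟺ p ∣ num(…)`** (`‖j‖_p = 1`). [cite: Washington1997, Thm. 5.11 and Cor. 5.13] -/
theorem norm_generalizedBernoulli_le_inv_iff_dvd_num {c : ℕ} [NeZero c] (hcp : c.Coprime p)
    (θ : DirichletCharacter ℚ_[p] c) (η : ℕ → ℤ) (hη : ∀ a : ℕ, θ (a : ZMod c) = (η a : ℚ_[p]))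
    {j : ℕ} (h2j : 2 ≤ j) (hjp : j ≤ p - 2) :
    ‖generalizedBernoulli j θ‖ ≤ (p : ℝ)⁻¹ ↔
      (p : ℤ) ∣ (∑ a ∈ Finset.range c, (η a : ℚ) * genBernoulliCoeff j c a).num := by
  rw [← norm_inv_natCast_mul_le_inv_iff (by omega : j ≠ 0) (by omega : j < p)]
  exact norm_inv_mul_generalizedBernoulli_le_inv_iff_dvd_num hcp θ η hη h2j hjp

/-- **B1's premise on the class, numerically.** For class data `(m, χ_e, ε, k)` with `χ_e(a) = ε(a)` at EVERY `a ∈ ℕ` (as produced by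
`KrizLiBinders.exists_krizLiData_of_cmRamified`), `m ⊥ p`, `2 ≤ k ≤ p − 2`:
`‖((p−k):ℚ_p)⁻¹·B_{p−k,χ_e}‖ ≤ p⁻¹ ⟺ p ∣ num(∑_{a<m} ε(a)·m^{p−k−1}B_{p−k}(a/m))`. [cite: Washington1997, Thm. 5.11 and Cor. 5.13] [cite: KrizLi2019, Thm. 1.20 (p. 8)] -/
theorem classFactor_le_inv_iff_dvd_num {m : ℕ} [NeZero m] (hmp : m.Coprime p) (χ : DirichletCharacter ℚ_[p] m)
    (ε : ℕ → ℤ) (hε : ∀ a : ℕ, χ (a : ZMod m) = (ε a : ℚ_[p])) {k : ℕ} (hk2 : 2 ≤ k) (hkp : k ≤ p - 2) :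
    ‖((p - k : ℕ) : ℚ_[p])⁻¹ * generalizedBernoulli (p - k) χ‖ ≤ (p : ℝ)⁻¹ ↔
      (p : ℤ) ∣ (∑ a ∈ Finset.range m, (ε a : ℚ) * genBernoulliCoeff (p - k) m a).num :=
  norm_inv_mul_generalizedBernoulli_le_inv_iff_dvd_num hmp χ ε hε (by omega) (by omega)

end Summit.BirchSwinnertonDyer.BirchSwinnertonDyer.Theorems.PrintCFram.KummerDictionary

end
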